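import Mathlib.Analysis.SumIntegralComparisons
import Literature.NumberTheory.Sieve.BombieriAsymptoticSieveProofs
import Literature.NumberTheory.Sieve.BombieriAsymptoticSieveVectorLambda
import HarnessLib

/-!
# Bombieri's asymptotic sieve, vector weights: [FriedlanderIwaniecPisa1978] Lemma 3 for `K = ℚ` and a vector `(k)`

Topic `Literature/NumberTheory/Sieve`, companion ("Proofs") file of
`BombieriAsymptoticSieveVector.lean`. Source: J. Friedlander, H. Iwaniec, *On Bombieri's asymptotic
sieve*, Ann. Scuola Norm. Sup. Pisa Cl. Sci. (4) **5** (1978) 719–756 [FriedlanderIwaniecPisa1978],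
Lemma 3 (p. 727): for `K = ℚ`, `∑_{m ≤ x} Λ_{(k)}(m) = γ_{(k)} x (log x)^{|k|−1} + O(x (log x)^{|k|−2})`,
`γ_{(k)} = (k)!/(|k|−1)!`, for every vector `(k)` with `max k_ν ≥ 2` (printed: by induction from
the prime ideal theorem). This is the main-term evaluation entering the proof of Theorem 1 through
the comparison with the sequence `a_n ≡ 1` (p. 740).

Proved here ELEMENTARILY from the tree's scalar case (`FI1978_lemma3_rat_holds`:
`∑_{m ≤ x} Λ_k(m) = k x (log x)^{k−1} + O_k(x (log x)^{k−2})`, `k ≥ 2`, itself from Selberg's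
formula) by induction over the vector, written `(k) = (k₁, …, k_{r−1}, a)` with `a ≥ 2` innermost:
prepending a rank `0` changes nothing (`Λ₀ = δ`); prepending a rank `1` is the convolution with
`Λ`, evaluated by the weighted Mertens estimate `∑_{d ≤ x} Λ(d) d⁻¹ (log x/d)^m =
(log x)^{m+1}/(m+1) + O((log x)^m)` (`abs_sum_vonMangoldt_div_mul_pow_log_sub_le`) — no prime number
theorem is needed; prepending a rank `k ≥ 2` is the convolution of two functions with summatory
asymptotics `c x (log x)^m + O(x(1 + log x)^{m−1})`, `m ≥ 1`, evaluated by discrete partial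
summation (`sum_Ioc_mul_eq_sub_sum_range`), the sum–integral comparison
`∑_{n ≤ x} (log x/n)^p/n = (log x)^{p+1}/(p+1) + O((log x)^p)` (`abs_sum_pow_log_div_sub_le`), the
binomial theorem, and the Beta-value identity `∑_i (−1)^i (q choose i)/(m+i+1) = m! q!/(m+q+1)!`
(`altSum_choose_div_eq`), which is where `γ_{(k)}` comes from.

Main results: `lambdaVec_concat_summatory` (the `O`-form for `Λ_(k', a)`, `a ≥ 2`) and
`lambdaVec_concat_summatory_eventually` (the `ε`-form used in the proof of Theorem 1).
No definitions are introduced.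
-/

noncomputable section

open Filter Finset ArithmeticFunction
-- `open ArithmeticFunction` provides the notation `Λ`; do not open `ArithmeticFunction.vonMangoldt`.
open scoped ArithmeticFunction.Moebius ArithmeticFunction.zeta Topology

namespace Literature.NumberTheory.Sieve

namespace BombieriSieve

open MeasureTheory SelbergSymmetry

/-! ### The scalar input in the shape `c x (log x)^m + O(x (1 + log x)^{m−1})` -/

/-- [FriedlanderIwaniecPisa1978] Lemma 3, scalar `k = p + 2 ≥ 2`, in the shape used by the
induction: `|∑_{n ≤ x} Λ_{p+2}(n) − (p+2) x (log x)^{p+1}| ≤ C x (1 + log x)^p` for `x ≥ 1`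
(from `FI1978_lemma3_rat_holds`, using `log(cx) ≤ (1 + log c)(1 + log x)`).
[cite: FriedlanderIwaniecPisa1978, Lemma 3 (K = Q, scalar)] -/
theorem generalizedVonMangoldt_summatory (p : ℕ) :
    ∃ C : ℝ, ∀ x : ℝ, 1 ≤ x →
      |∑ n ∈ Ioc 0 ⌊x⌋₊, generalizedVonMangoldt (p + 2) n -
          (p + 2 : ℝ) * x * Real.log x ^ (p + 1)| ≤ C * x * (1 + Real.log x) ^ p := by
  obtain ⟨c, hc1, h⟩ := FI1978_lemma3_rat_holds
  refine ⟨c ^ (p + 2) * (1 + Real.log c) ^ p, fun x hx => ?_⟩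
  have hx0 : 0 < x := by linarith
  have hc0 : 0 < c := by linarith
  have hlogc : 0 ≤ Real.log c := Real.log_nonneg hc1
  have hL0 : 0 ≤ Real.log x := Real.log_nonneg hx
  have h' := h (p + 2) (by omega) x hx
  simp only [show p + 2 - 1 = p + 1 from rfl, show p + 2 - 2 = p from rfl] at h'
  push_cast at h'
  refine h'.trans ?_
  have hlcx : Real.log (c * x) ≤ (1 + Real.log c) * (1 + Real.log x) := by
    rw [Real.log_mul hc0.ne' hx0.ne']
    nlinarith
  have hlcx0 : 0 ≤ Real.log (c * x) := Real.log_nonneg (by nlinarith)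
  calc c ^ (p + 2) * x * Real.log (c * x) ^ p
      ≤ c ^ (p + 2) * x * ((1 + Real.log c) * (1 + Real.log x)) ^ p := by gcongr
    _ = c ^ (p + 2) * (1 + Real.log c) ^ p * x * (1 + Real.log x) ^ p := by rw [mul_pow]; ring

/-! ### The sum–integral comparison `∑_{n ≤ x} (log x/n)^p/n = (log x)^{p+1}/(p+1) + O((log x)^p)` -/

/-- `t ↦ (log x − log t)^p t⁻¹` is antitone on `[1, x]`. [folklore] -/
theorem antitoneOn_pow_log_div (p : ℕ) (x : ℝ) :
    AntitoneOn (fun t => (Real.log x - Real.log t) ^ p * t⁻¹) (Set.Icc 1 x) := by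
  intro s hs t ht hst
  have hs0 : 0 < s := by linarith [hs.1]
  have ht0 : 0 < t := by linarith [ht.1]
  have h1 : Real.log x - Real.log t ≤ Real.log x - Real.log s := by
    linarith [Real.log_le_log hs0 hst]
  have h2 : 0 ≤ Real.log x - Real.log t := by linarith [Real.log_le_log ht0 ht.2]
  have h3 : t⁻¹ ≤ s⁻¹ := (inv_le_inv₀ ht0 hs0).mpr hst
  exact mul_le_mul (pow_le_pow_left₀ h2 h1 _) h3 (inv_nonneg.mpr ht0.le)
    (pow_nonneg (h2.trans h1) _)

/-- **Sum versus integral for `(log x/n)^p/n`**: for `x ≥ 1`,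
`|∑_{n ≤ x} (log x/n)^p/n − (log x)^{p+1}/(p+1)| ≤ (log x)^p` (the summand `(log x − log t)^p/t` is
antitone on `[1, x]` with integral `(log x)^{p+1}/(p+1)`, `integral_pow_log_div`). [folklore] -/
theorem abs_sum_pow_log_div_sub_le (p : ℕ) {x : ℝ} (hx : 1 ≤ x) :
    |∑ n ∈ Ioc 0 ⌊x⌋₊, Real.log (x / n) ^ p / n - Real.log x ^ (p + 1) / (p + 1)| ≤
      Real.log x ^ p := by
  set N := ⌊x⌋₊ with hN
  set L := Real.log x with hL
  set φ : ℝ → ℝ := fun t => (L - Real.log t) ^ p * t⁻¹ with hφ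
  have hx0 : 0 < x := by linarith
  have hL0 : 0 ≤ L := Real.log_nonneg hx
  have hN1 : 1 ≤ N := Nat.le_floor (by simpa using hx)
  have hNx : (N : ℝ) ≤ x := Nat.floor_le hx0.le
  have hN1' : (1 : ℝ) ≤ N := by exact_mod_cast hN1
  have hxN : x - N ≤ 1 := by
    have := Nat.lt_floor_add_one x
    rw [← hN] at this
    linarith
  have hanti := antitoneOn_pow_log_div p x
  have hφ1 : φ 1 = L ^ p := by simp [hφ]
  have hφ0 : ∀ t ∈ Set.Icc 1 x, 0 ≤ φ t := fun t ht =>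
    mul_nonneg (pow_nonneg (by linarith [Real.log_le_log (by linarith [ht.1]) ht.2]) _)
      (inv_nonneg.mpr (by linarith [ht.1]))
  -- the sum in terms of `φ`
  have hIoc : Finset.Ico 1 (N + 1) = Finset.Ioc 0 N := Finset.Ico_add_one_add_one_eq_Ioc 0 N
  have hsum : ∑ n ∈ Ioc 0 N, Real.log (x / n) ^ p / n = ∑ n ∈ Ico 1 (N + 1), φ n := by
    rw [hIoc]
    refine Finset.sum_congr rfl fun n hn => ?_
    have hn1 : 0 < n := (Finset.mem_Ioc.mp hn).1
    have hn0 : (n : ℝ) ≠ 0 := by exact_mod_cast (by omega : n ≠ 0)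
    simp only [hφ]
    rw [Real.log_div hx0.ne' hn0, div_eq_mul_inv]
  -- the integral
  have hint : ∫ t in (1 : ℝ)..x, φ t = L ^ (p + 1) / (p + 1) := by
    rw [intervalIntegral.integral_of_le hx]
    exact integral_pow_log_div p hx
  have hii : ∀ a b : ℝ, 1 ≤ a → a ≤ b → b ≤ x → IntervalIntegrable φ volume a b := by
    intro a b ha hab hb
    refine ((continuousOn_pow_log_div p x).mono ?_).intervalIntegrable
    intro t ht
    rw [Set.uIcc_of_le hab] at ht
    exact ⟨ha.trans ht.1, ht.2.trans hb⟩
  have hsplit : ∫ t in (1 : ℝ)..x, φ t = (∫ t in (1 : ℝ)..N, φ t) + ∫ t in (N : ℝ)..x, φ t :=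
    (intervalIntegral.integral_add_adjacent_intervals (hii 1 N le_rfl hN1' hNx)
      (hii N x hN1' hNx le_rfl)).symm
  -- the tail `0 ≤ ∫_N^x φ ≤ φ(N) (x − N) ≤ L^p`
  have htail0 : 0 ≤ ∫ t in (N : ℝ)..x, φ t :=
    intervalIntegral.integral_nonneg hNx fun t ht => hφ0 t ⟨hN1'.trans ht.1, ht.2⟩
  have htail1 : ∫ t in (N : ℝ)..x, φ t ≤ L ^ p := by
    have hb : ∀ t ∈ Set.uIoc (N : ℝ) x, ‖φ t‖ ≤ φ N := by
      intro t ht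
      rw [Set.uIoc_of_le hNx] at ht
      rw [Real.norm_of_nonneg (hφ0 t ⟨hN1'.trans ht.1.le, ht.2⟩)]
      exact hanti ⟨hN1', hNx⟩ ⟨hN1'.trans ht.1.le, ht.2⟩ ht.1.le
    have h := intervalIntegral.norm_integral_le_of_norm_le_const hb
    rw [Real.norm_eq_abs, abs_of_nonneg (by linarith)] at h
    have hφN : φ N ≤ φ 1 := hanti ⟨le_rfl, hx⟩ ⟨hN1', hNx⟩ hN1'
    have hφN0 : 0 ≤ φ N := hφ0 N ⟨hN1', hNx⟩
    calc ∫ t in (N : ℝ)..x, φ t ≤ φ N * |x - N| := h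
      _ ≤ φ 1 * 1 := mul_le_mul hφN (by rw [abs_of_nonneg (by linarith)]; exact hxN)
          (abs_nonneg _) (hφ0 1 ⟨le_rfl, hx⟩)
      _ = L ^ p := by rw [hφ1, mul_one]
  -- comparison on `[1, N]`
  have hantiN : AntitoneOn φ (Set.Icc ((1 : ℕ) : ℝ) ((N : ℕ) : ℝ)) := by
    refine hanti.mono ?_
    intro t ht
    exact ⟨by simpa using ht.1, ht.2.trans hNx⟩
  have hup : ∑ i ∈ Ico 1 N, φ ((i + 1 : ℕ) : ℝ) ≤ ∫ t in (1 : ℝ)..N, φ t := by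
    have := AntitoneOn.sum_le_integral_Ico hN1 hantiN
    simpa using this
  have hlow : ∫ t in (1 : ℝ)..N, φ t ≤ ∑ n ∈ Ico 1 N, φ n := by
    have := AntitoneOn.integral_le_sum_Ico hN1 hantiN
    simpa using this
  -- the sum split as `φ(1) + ∑_{2 ≤ n ≤ N}` and bounded below by `∑_{n < N}`
  have hS1 : ∑ n ∈ Ico 1 (N + 1), φ n = φ 1 + ∑ i ∈ Ico 1 N, φ ((i + 1 : ℕ) : ℝ) := by
    rw [Finset.sum_eq_sum_Ico_succ_bot (by omega : 1 < N + 1), Nat.cast_one]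
    congr 1
    rw [← Finset.sum_Ico_add' (f := fun n : ℕ => φ n) (c := 1)]
  have hS2 : ∑ n ∈ Ico 1 N, φ n ≤ ∑ n ∈ Ico 1 (N + 1), φ n :=
    Finset.sum_le_sum_of_subset_of_nonneg (Finset.Ico_subset_Ico_right (Nat.le_succ N))
      fun n hn _ => hφ0 n ⟨by exact_mod_cast (Finset.mem_Ico.mp hn).1,
        le_trans (by exact_mod_cast Nat.le_of_lt_succ (Finset.mem_Ico.mp hn).2) hNx⟩
  rw [hsum, ← hint, hsplit, abs_le]
  constructor
  · linarith [hφ1]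
  · linarith [hφ1]

/-! ### The Beta-value identity `∑_i (−1)^i (q choose i)/(m+i+1) = m! q!/(m+q+1)!` -/

/-- `∑_{i=0}^{q} (−1)^i (q choose i)/(m + i + 1) = m! q!/(m + q + 1)!` (the value `B(m+1, q+1)` of
Euler's Beta integral `∫₀¹ t^m (1−t)^q dt`; proved by induction on `q` via Pascal's rule:
`A(m, q+1) = A(m, q) − A(m+1, q)`). [folklore] -/
theorem altSum_choose_div_eq (m q : ℕ) :
    ∑ i ∈ Finset.range (q + 1), (-1 : ℝ) ^ i * (q.choose i : ℝ) / ((m : ℝ) + i + 1) =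
      ((m.factorial : ℝ) * q.factorial) / ((m + q + 1).factorial : ℝ) := by
  induction q generalizing m with
  | zero =>
    rw [Finset.sum_range_one, Nat.choose_zero_right, Nat.factorial_zero, Nat.add_zero,
      Nat.factorial_succ]
    push_cast
    have hm : (0 : ℝ) < m.factorial := by exact_mod_cast Nat.factorial_pos m
    field_simp
    ring
  | succ q ih =>
    -- Pascal: split off `i = 0` and shift
    have hsplit : ∑ i ∈ Finset.range (q + 1 + 1), (-1 : ℝ) ^ i * ((q + 1).choose i : ℝ) /
        ((m : ℝ) + i + 1) =
        (∑ i ∈ Finset.range (q + 1), (-1 : ℝ) ^ i * (q.choose i : ℝ) / ((m : ℝ) + i + 1)) -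
          ∑ i ∈ Finset.range (q + 1), (-1 : ℝ) ^ i * (q.choose i : ℝ) /
            (((m + 1 : ℕ) : ℝ) + i + 1) := by
      rw [Finset.sum_range_succ' (fun i => (-1 : ℝ) ^ i * ((q + 1).choose i : ℝ) /
        ((m : ℝ) + i + 1))]
      have h1 : ∀ i ∈ Finset.range (q + 1),
          (-1 : ℝ) ^ (i + 1) * ((q + 1).choose (i + 1) : ℝ) / ((m : ℝ) + ((i + 1 : ℕ) : ℝ) + 1) =
            (-1 : ℝ) ^ (i + 1) * (q.choose (i + 1) : ℝ) / ((m : ℝ) + ((i + 1 : ℕ) : ℝ) + 1) -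
              (-1 : ℝ) ^ i * (q.choose i : ℝ) / (((m + 1 : ℕ) : ℝ) + i + 1) := by
        intro i _
        rw [Nat.choose_succ_succ', Nat.cast_add, pow_succ]
        push_cast
        ring
      rw [Finset.sum_congr rfl h1, Finset.sum_sub_distrib]
      -- the shifted sum recombines with the `i = 0` term to the full `q`-sum
      have h2 : (∑ i ∈ Finset.range (q + 1),
          (-1 : ℝ) ^ (i + 1) * (q.choose (i + 1) : ℝ) / ((m : ℝ) + ((i + 1 : ℕ) : ℝ) + 1)) +
            (-1 : ℝ) ^ 0 * ((q + 1).choose 0 : ℝ) / ((m : ℝ) + ((0 : ℕ) : ℝ) + 1) =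
          ∑ i ∈ Finset.range (q + 1), (-1 : ℝ) ^ i * (q.choose i : ℝ) / ((m : ℝ) + i + 1) := by
        rw [Finset.sum_range_succ' (fun i => (-1 : ℝ) ^ i * (q.choose i : ℝ) / ((m : ℝ) + i + 1)),
          Finset.sum_range_succ, Nat.choose_succ_self, Nat.cast_zero, mul_zero, zero_div,
          add_zero, Nat.choose_zero_right, Nat.choose_zero_right]
      linarith [h2]
    rw [hsplit, ih m, ih (m + 1)]
    have hf1 : ((m + 1).factorial : ℝ) = (m + 1) * m.factorial := by
      rw [Nat.factorial_succ]; push_cast; ring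
    have hf2 : ((q + 1).factorial : ℝ) = (q + 1) * q.factorial := by
      rw [Nat.factorial_succ]; push_cast; ring
    have hf3 : ((m + (q + 1) + 1).factorial : ℝ) = (m + q + 2) * (m + q + 1).factorial := by
      rw [show m + (q + 1) + 1 = (m + q + 1) + 1 by ring, Nat.factorial_succ]; push_cast; ring
    have hf4 : ((m + 1 + q + 1).factorial : ℝ) = (m + q + 2) * (m + q + 1).factorial := by
      rw [show m + 1 + q + 1 = (m + q + 1) + 1 by ring, Nat.factorial_succ]; push_cast; ring
    rw [hf1, hf2, hf3, hf4]
    have h0 : (0 : ℝ) < (m + q + 1).factorial := by exact_mod_cast Nat.factorial_pos _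
    have h1 : (0 : ℝ) < (m : ℝ) + q + 2 := by positivity
    field_simp
    ring

/-! ### `∑_{n ≤ x} (log n)^q (log x/n)^m / n` by the binomial theorem -/

/-- For `x ≥ 1`: `|∑_{n ≤ x} (log n)^q (log x/n)^m/n − (m! q!/(m+q+1)!) (log x)^{m+q+1}| ≤
2^q (log x)^{m+q}` (expand `(log n)^q = (log x − log x/n)^q`, apply
`abs_sum_pow_log_div_sub_le` to each `∑ (log x/n)^{m+i}/n` and `altSum_choose_div_eq`). [folklore] -/
theorem abs_sum_pow_log_mul_pow_log_div_sub_le (m q : ℕ) {x : ℝ} (hx : 1 ≤ x) :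
    |∑ n ∈ Ioc 0 ⌊x⌋₊, Real.log n ^ q * Real.log (x / n) ^ m / n -
        ((m.factorial : ℝ) * q.factorial) / ((m + q + 1).factorial : ℝ) *
          Real.log x ^ (m + q + 1)| ≤ 2 ^ q * Real.log x ^ (m + q) := by
  set N := ⌊x⌋₊ with hN
  set L := Real.log x with hL
  have hx0 : 0 < x := by linarith
  have hL0 : 0 ≤ L := Real.log_nonneg hx
  -- `T_p = ∑ (log x/n)^p / n`, its main term and error
  set T : ℕ → ℝ := fun p => ∑ n ∈ Ioc 0 N, Real.log (x / n) ^ p / n with hT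
  have hTp : ∀ p : ℕ, |T p - L ^ (p + 1) / (p + 1)| ≤ L ^ p := fun p =>
    abs_sum_pow_log_div_sub_le p hx
  -- binomial expansion, termwise
  have hexp : ∀ n ∈ Ioc 0 N, Real.log n ^ q * Real.log (x / n) ^ m / n =
      ∑ i ∈ Finset.range (q + 1),
        (q.choose i : ℝ) * (-1) ^ i * L ^ (q - i) * (Real.log (x / n) ^ (m + i) / n) := by
    intro n hn
    have hn0 : (n : ℝ) ≠ 0 := by exact_mod_cast (Finset.mem_Ioc.mp hn).1.ne'
    have hlog : Real.log n = -Real.log (x / n) + L := by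
      rw [Real.log_div hx0.ne' hn0]; ring
    rw [hlog, add_pow, Finset.sum_mul, Finset.sum_div]
    refine Finset.sum_congr rfl fun i _ => ?_
    rw [neg_pow, pow_add]
    ring
  have hswap : ∑ n ∈ Ioc 0 N, Real.log n ^ q * Real.log (x / n) ^ m / n =
      ∑ i ∈ Finset.range (q + 1), (q.choose i : ℝ) * (-1) ^ i * L ^ (q - i) * T (m + i) := by
    rw [Finset.sum_congr rfl hexp, Finset.sum_comm]
    refine Finset.sum_congr rfl fun i _ => ?_
    rw [hT, Finset.mul_sum]
  -- the main term via the Beta-value identity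
  have hmain : ∑ i ∈ Finset.range (q + 1),
      (q.choose i : ℝ) * (-1) ^ i * L ^ (q - i) * (L ^ (m + i + 1) / (m + i + 1)) =
      ((m.factorial : ℝ) * q.factorial) / ((m + q + 1).factorial : ℝ) * L ^ (m + q + 1) := by
    rw [← altSum_choose_div_eq m q, Finset.sum_mul]
    refine Finset.sum_congr rfl fun i hi => ?_
    have hiq : i ≤ q := Nat.lt_succ_iff.mp (Finset.mem_range.mp hi)
    have hpow : L ^ (q - i) * L ^ (m + i + 1) = L ^ (m + q + 1) := by
      rw [← pow_add]; congr 1; omega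
    calc (q.choose i : ℝ) * (-1) ^ i * L ^ (q - i) * (L ^ (m + i + 1) / (m + i + 1))
        = (-1) ^ i * (q.choose i : ℝ) / (m + i + 1) * (L ^ (q - i) * L ^ (m + i + 1)) := by ring
      _ = (-1) ^ i * (q.choose i : ℝ) / (m + i + 1) * L ^ (m + q + 1) := by rw [hpow]
  rw [hswap, ← hmain, ← Finset.sum_sub_distrib]
  refine (Finset.abs_sum_le_sum_abs _ _).trans ?_
  have hterm : ∀ i ∈ Finset.range (q + 1),
      |(q.choose i : ℝ) * (-1) ^ i * L ^ (q - i) * T (m + i) -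
          (q.choose i : ℝ) * (-1) ^ i * L ^ (q - i) * (L ^ (m + i + 1) / (m + i + 1))| ≤
        (q.choose i : ℝ) * L ^ (m + q) := by
    intro i hi
    have hiq : i ≤ q := Nat.lt_succ_iff.mp (Finset.mem_range.mp hi)
    have h := hTp (m + i)
    push_cast at h
    rw [← mul_sub, abs_mul, abs_mul, abs_mul, abs_pow, abs_neg, abs_one, one_pow, mul_one,
      Nat.abs_cast, abs_of_nonneg (pow_nonneg hL0 _)]
    calc (q.choose i : ℝ) * L ^ (q - i) * |T (m + i) - L ^ (m + i + 1) / (m + i + 1)|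
        ≤ (q.choose i : ℝ) * L ^ (q - i) * L ^ (m + i) :=
          mul_le_mul_of_nonneg_left h (by positivity)
      _ = (q.choose i : ℝ) * L ^ (m + q) := by
          rw [mul_assoc, ← pow_add]; congr 2; omega
  refine (Finset.sum_le_sum hterm).trans (le_of_eq ?_)
  rw [← Finset.sum_mul]
  congr 1
  have := Nat.sum_range_choose q
  exact_mod_cast this

/-! ### Discrete partial summation against `φ(n) = (log x/n)^m / n` -/

/-- `u^{k+1} − v^{k+1} ≤ (k+1) u^k (u − v)` for `0 ≤ v ≤ u`. [folklore] -/
theorem pow_succ_sub_pow_succ_le {u v : ℝ} (hv0 : 0 ≤ v) (hvu : v ≤ u) (k : ℕ) :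
    u ^ (k + 1) - v ^ (k + 1) ≤ (k + 1) * u ^ k * (u - v) := by
  have hu0 : 0 ≤ u := hv0.trans hvu
  have hgeom := geom_sum₂_mul u v (k + 1)
  have hS : ∑ i ∈ Finset.range (k + 1), u ^ i * v ^ (k + 1 - 1 - i) ≤ (k + 1) * u ^ k := by
    have hterm : ∀ i ∈ Finset.range (k + 1), u ^ i * v ^ (k + 1 - 1 - i) ≤ u ^ k := by
      intro i hi
      have hik : i + (k + 1 - 1 - i) = k := by
        have := Finset.mem_range.mp hi
        omega
      calc u ^ i * v ^ (k + 1 - 1 - i) ≤ u ^ i * u ^ (k + 1 - 1 - i) :=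
            mul_le_mul_of_nonneg_left (pow_le_pow_left₀ hv0 hvu _) (pow_nonneg hu0 _)
        _ = u ^ k := by rw [← pow_add, hik]
    refine (Finset.sum_le_sum hterm).trans ?_
    rw [Finset.sum_const, Finset.card_range, nsmul_eq_mul]
    push_cast
    ring_nf
    rfl
  calc u ^ (k + 1) - v ^ (k + 1)
      = (∑ i ∈ Finset.range (k + 1), u ^ i * v ^ (k + 1 - 1 - i)) * (u - v) := hgeom.symm
    _ ≤ (k + 1) * u ^ k * (u - v) := mul_le_mul_of_nonneg_right hS (sub_nonneg.mpr hvu)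

/-- The model increments `ψ(n) = n (log n)^{k+1} − (n−1)(log (n−1))^{k+1}` satisfy
`(log n)^{k+1} ≤ ψ(n) ≤ (log n)^{k+1} + (k+1)(log n)^k` for `n ≥ 1`
(`log n − log(n−1) ≤ 1/(n−1)`). [folklore] -/
theorem model_increment_bounds (k : ℕ) {n : ℕ} (hn : 1 ≤ n) :
    Real.log n ^ (k + 1) ≤
        n * Real.log n ^ (k + 1) - ((n : ℝ) - 1) * Real.log ((n : ℝ) - 1) ^ (k + 1) ∧
      n * Real.log n ^ (k + 1) - ((n : ℝ) - 1) * Real.log ((n : ℝ) - 1) ^ (k + 1) ≤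
        Real.log n ^ (k + 1) + (k + 1) * Real.log n ^ k := by
  rcases Nat.eq_or_lt_of_le hn with rfl | hn2
  · simp only [Nat.cast_one, Real.log_one, sub_self, Real.log_zero]
    have h0 : (0 : ℝ) ≤ (k + 1) * (0 : ℝ) ^ k := by positivity
    constructor <;> linarith
  · have hn1 : (1 : ℝ) < n := by exact_mod_cast hn2
    have hm0 : (0 : ℝ) < (n : ℝ) - 1 := by linarith
    have hm1 : (1 : ℝ) ≤ (n : ℝ) - 1 := by
      have : (2 : ℝ) ≤ n := by exact_mod_cast hn2
      linarith
    have hlm0 : 0 ≤ Real.log ((n : ℝ) - 1) := Real.log_nonneg hm1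
    have hlmn : Real.log ((n : ℝ) - 1) ≤ Real.log n := Real.log_le_log hm0 (by linarith)
    have hdiff : Real.log n - Real.log ((n : ℝ) - 1) ≤ 1 / ((n : ℝ) - 1) := by
      have hn0 : (n : ℝ) ≠ 0 := by positivity
      rw [← Real.log_div hn0 hm0.ne']
      have h1 := Real.log_le_sub_one_of_pos (div_pos (by positivity) hm0)
      have h2 : (n : ℝ) / ((n : ℝ) - 1) - 1 = 1 / ((n : ℝ) - 1) := by
        field_simp; ring
      linarith
    have hpow := pow_succ_sub_pow_succ_le hlm0 hlmn k
    have hid : (n : ℝ) * Real.log n ^ (k + 1) - ((n : ℝ) - 1) * Real.log ((n : ℝ) - 1) ^ (k + 1) =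
        Real.log n ^ (k + 1) +
          ((n : ℝ) - 1) * (Real.log n ^ (k + 1) - Real.log ((n : ℝ) - 1) ^ (k + 1)) := by ring
    rw [hid]
    constructor
    · have : 0 ≤ Real.log n ^ (k + 1) - Real.log ((n : ℝ) - 1) ^ (k + 1) :=
        sub_nonneg.mpr (pow_le_pow_left₀ hlm0 hlmn _)
      nlinarith
    · have hln0 : 0 ≤ Real.log n := hlm0.trans hlmn
      have h1 : ((n : ℝ) - 1) * (Real.log n ^ (k + 1) - Real.log ((n : ℝ) - 1) ^ (k + 1)) ≤
          ((n : ℝ) - 1) * ((k + 1) * Real.log n ^ k * (Real.log n - Real.log ((n : ℝ) - 1))) :=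
        mul_le_mul_of_nonneg_left hpow hm0.le
      have h2 : ((n : ℝ) - 1) * ((k + 1) * Real.log n ^ k * (Real.log n - Real.log ((n : ℝ) - 1))) ≤
          (k + 1) * Real.log n ^ k := by
        calc ((n : ℝ) - 1) * ((k + 1) * Real.log n ^ k * (Real.log n - Real.log ((n : ℝ) - 1)))
            = ((k + 1) * Real.log n ^ k) * (((n : ℝ) - 1) * (Real.log n - Real.log ((n : ℝ) - 1))) := by
              ring
          _ ≤ ((k + 1) * Real.log n ^ k) * 1 := by
              refine mul_le_mul_of_nonneg_left ?_ (by positivity)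
              calc ((n : ℝ) - 1) * (Real.log n - Real.log ((n : ℝ) - 1))
                  ≤ ((n : ℝ) - 1) * (1 / ((n : ℝ) - 1)) := mul_le_mul_of_nonneg_left hdiff hm0.le
                _ = 1 := by field_simp
          _ = (k + 1) * Real.log n ^ k := mul_one _
      linarith

/-- The model partial sums telescope: `∑_{n ≤ N} ψ(n) = N (log N)^{k+1}`. [folklore] -/
theorem sum_model_increment (k N : ℕ) :
    ∑ n ∈ Ioc 0 N, ((n : ℝ) * Real.log n ^ (k + 1) -
        ((n : ℝ) - 1) * Real.log ((n : ℝ) - 1) ^ (k + 1)) = N * Real.log N ^ (k + 1) := by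
  induction N with
  | zero => simp
  | succ N ih =>
    rw [Finset.sum_Ioc_succ_top (Nat.zero_le N), ih]
    push_cast
    ring

/-- **Partial summation against `φ(n) = (log x/n)^m/n`**: if
`|∑_{n ≤ y} g(n) − c y (log y)^{p+1}| ≤ C y (1 + log y)^p` for all `y ≥ 1`, then for every `m`,
`∑_{n ≤ x} g(n) n⁻¹ (log x/n)^m = c (m!(p+1)!/(m+p+2)!) (log x)^{m+p+2} + O((1 + log x)^{m+p+1})`
(`x ≥ 1`; no sign condition on `g` is needed). Discrete Abel summation
(`sum_Ioc_mul_eq_sub_sum_range`) against the antitone weight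
`φ`, with `∑_{n ≤ y} g(n)` replaced by the telescoping model `y (log y)^{p+1}`
(`sum_model_increment`, `model_increment_bounds`), then `abs_sum_pow_log_mul_pow_log_div_sub_le`.
[folklore] -/
theorem weighted_sum_asymp (g : ℕ → ℝ) {c C : ℝ} {p : ℕ}
    (hg : ∀ y : ℝ, 1 ≤ y →
      |∑ n ∈ Ioc 0 ⌊y⌋₊, g n - c * y * Real.log y ^ (p + 1)| ≤ C * y * (1 + Real.log y) ^ p)
    (m : ℕ) : ∃ C' : ℝ, ∀ x : ℝ, 1 ≤ x →
      |∑ n ∈ Ioc 0 ⌊x⌋₊, g n / n * Real.log (x / n) ^ m -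
          c * (((m.factorial : ℝ) * (p + 1).factorial) / ((m + p + 2).factorial : ℝ)) *
            Real.log x ^ (m + p + 2)| ≤ C' * (1 + Real.log x) ^ (m + p + 1) := by
  -- `C ≥ 0` (from `y = 1`)
  have hC0 : 0 ≤ C := by
    have h := hg 1 le_rfl
    have h2 : (0 : ℝ) ≤ C * 1 * (1 + Real.log 1) ^ p := (abs_nonneg _).trans h
    simpa using h2
  refine ⟨|c| * 2 ^ (p + 1) + |c| * (p + 1) * 2 + C * 2, fun x hx => ?_⟩
  set N := ⌊x⌋₊ with hN
  set L := Real.log x with hL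
  have hx0 : 0 < x := by linarith
  have hL0 : 0 ≤ L := Real.log_nonneg hx
  have hN1 : 1 ≤ N := Nat.le_floor (by simpa using hx)
  have hNx : (N : ℝ) ≤ x := Nat.floor_le hx0.le
  have h1L : 1 ≤ 1 + L := by linarith
  -- the weight `φ(n) = (log⁺ x/n)^m / n` (`= (log x/n)^m/n` for `1 ≤ n ≤ N`) and its properties
  set φ : ℕ → ℝ := fun n => max 0 (Real.log (x / n)) ^ m / n with hφ
  have hφ0 : ∀ n : ℕ, 0 ≤ φ n := fun n =>
    div_nonneg (pow_nonneg (le_max_left _ _) _) (Nat.cast_nonneg n)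
  have hφeq : ∀ n : ℕ, 1 ≤ n → n ≤ N → φ n = Real.log (x / n) ^ m / n := by
    intro n hn1 hnN
    have hn0 : (0 : ℝ) < n := by exact_mod_cast hn1
    have hnx : (n : ℝ) ≤ x := le_trans (by exact_mod_cast hnN) hNx
    have hl : 0 ≤ Real.log (x / n) := Real.log_nonneg ((one_le_div hn0).mpr hnx)
    simp only [hφ, max_eq_right hl]
  have hφanti : ∀ n : ℕ, 1 ≤ n → φ (n + 1) ≤ φ n := by
    intro n hn1
    have hn0 : (0 : ℝ) < n := by exact_mod_cast hn1
    have hn0' : (0 : ℝ) < (n + 1 : ℕ) := by positivity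
    have h1 : max 0 (Real.log (x / (n + 1 : ℕ))) ≤ max 0 (Real.log (x / n)) := by
      refine max_le_max le_rfl (Real.log_le_log (div_pos hx0 hn0') ?_)
      exact div_le_div_of_nonneg_left hx0.le hn0 (by push_cast; linarith)
    have h2 : ((n + 1 : ℕ) : ℝ)⁻¹ ≤ (n : ℝ)⁻¹ :=
      (inv_le_inv₀ hn0' hn0).mpr (by push_cast; linarith)
    simp only [hφ, div_eq_mul_inv]
    exact mul_le_mul (pow_le_pow_left₀ (le_max_left _ _) h1 _) h2 (inv_nonneg.mpr hn0'.le)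
      (pow_nonneg (le_max_left _ _) _)
  have hφle : ∀ n : ℕ, 1 ≤ n → (n : ℝ) * φ n ≤ L ^ m := by
    intro n hn1
    have hn0 : (0 : ℝ) < n := by exact_mod_cast hn1
    have h1 : max 0 (Real.log (x / n)) ≤ L := by
      refine max_le hL0 ?_
      rw [Real.log_div hx0.ne' hn0.ne']
      linarith [Real.log_nonneg (show (1 : ℝ) ≤ n by exact_mod_cast hn1)]
    simp only [hφ]
    rw [mul_div_cancel₀ _ hn0.ne']
    exact pow_le_pow_left₀ (le_max_left _ _) h1 _
  -- `T = ∑_{n ≤ N} φ(n) ≤ L^m (1 + L)`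
  set T := ∑ n ∈ Ioc 0 N, φ n with hT
  have hTle : T ≤ L ^ m * (1 + L) := by
    have h := (abs_le.mp (abs_sum_pow_log_div_sub_le m hx)).2
    have hTeq : T = ∑ n ∈ Ioc 0 N, Real.log (x / n) ^ m / n :=
      Finset.sum_congr rfl fun n hn => hφeq n (Finset.mem_Ioc.mp hn).1 (Finset.mem_Ioc.mp hn).2
    rw [hTeq]
    have h2 : L ^ (m + 1) / (m + 1) ≤ L ^ (m + 1) := div_le_self (pow_nonneg hL0 _) (by linarith)
    calc ∑ n ∈ Ioc 0 N, Real.log (x / n) ^ m / n ≤ L ^ (m + 1) / (m + 1) + L ^ m := by linarith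
      _ ≤ L ^ (m + 1) + L ^ m := by linarith
      _ = L ^ m * (1 + L) := by ring
  have hT0 : 0 ≤ T := Finset.sum_nonneg fun n _ => hφ0 n
  -- the sum of the statement in terms of `φ`
  have hSeq : ∑ n ∈ Ioc 0 N, g n / n * Real.log (x / n) ^ m = ∑ n ∈ Ioc 0 N, g n * φ n := by
    refine Finset.sum_congr rfl fun n hn => ?_
    rw [hφeq n (Finset.mem_Ioc.mp hn).1 (Finset.mem_Ioc.mp hn).2]
    ring
  -- the errors `E(k) = ∑_{n ≤ k} g(n) − c k (log k)^{p+1}`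
  set E : ℕ → ℝ := fun k => (∑ n ∈ Ioc 0 k, g n) - c * (k * Real.log k ^ (p + 1)) with hE
  have hE0 : E 0 = 0 := by simp [hE]
  have hEle : ∀ k : ℕ, 1 ≤ k → k ≤ N → |E k| ≤ C * (1 + L) ^ p * k := by
    intro k hk1 hkN
    have hk0 : (0 : ℝ) < k := by exact_mod_cast hk1
    have h := hg k (by exact_mod_cast hk1)
    rw [Nat.floor_natCast] at h
    have hlk : Real.log k ≤ L := Real.log_le_log hk0 (le_trans (by exact_mod_cast hkN) hNx)
    have hlk0 : 0 ≤ Real.log k := Real.log_nonneg (by exact_mod_cast hk1)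
    have hEk : E k = (∑ n ∈ Ioc 0 k, g n) - c * k * Real.log k ^ (p + 1) := by
      simp only [hE]; ring
    rw [hEk]
    calc |(∑ n ∈ Ioc 0 k, g n) - c * k * Real.log k ^ (p + 1)| ≤ C * k * (1 + Real.log k) ^ p := h
      _ ≤ C * k * (1 + L) ^ p := by gcongr
      _ = C * (1 + L) ^ p * k := by ring
  -- Abel summation, three times
  have hAg := sum_Ioc_mul_eq_sub_sum_range g φ N
  have hAψ : ∑ n ∈ Ioc 0 N, ((n : ℝ) * Real.log n ^ (p + 1) -
      ((n : ℝ) - 1) * Real.log ((n : ℝ) - 1) ^ (p + 1)) * φ n =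
      (N * Real.log N ^ (p + 1)) * φ N -
        ∑ k ∈ Finset.range N, (k * Real.log k ^ (p + 1)) * (φ (k + 1) - φ k) := by
    rw [sum_Ioc_mul_eq_sub_sum_range, sum_model_increment]
    congr 1
    exact Finset.sum_congr rfl fun k _ => by rw [sum_model_increment]
  have hA1 : T = N * φ N - ∑ k ∈ Finset.range N, (k : ℝ) * (φ (k + 1) - φ k) := by
    have h := sum_Ioc_mul_eq_sub_sum_range (fun _ => (1 : ℝ)) φ N
    simp only [one_mul, Finset.sum_const, Nat.card_Ioc, Nat.sub_zero, nsmul_eq_mul, mul_one] at h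
    rw [hT, h]
  -- Step 1: `S_g − c S_ψ = E(N) φ(N) − ∑_{k<N} E(k) (φ(k+1) − φ(k))`
  have hdiff : (∑ n ∈ Ioc 0 N, g n * φ n) -
      c * ∑ n ∈ Ioc 0 N, ((n : ℝ) * Real.log n ^ (p + 1) -
        ((n : ℝ) - 1) * Real.log ((n : ℝ) - 1) ^ (p + 1)) * φ n =
      E N * φ N - ∑ k ∈ Finset.range N, E k * (φ (k + 1) - φ k) := by
    rw [hAg, hAψ]
    simp only [hE, sub_mul, mul_assoc, Finset.sum_sub_distrib, ← Finset.mul_sum]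
    ring
  have hstep1 : |(∑ n ∈ Ioc 0 N, g n * φ n) -
      c * ∑ n ∈ Ioc 0 N, ((n : ℝ) * Real.log n ^ (p + 1) -
        ((n : ℝ) - 1) * Real.log ((n : ℝ) - 1) ^ (p + 1)) * φ n| ≤ C * (1 + L) ^ p * T := by
    rw [hdiff]
    have hK0 : 0 ≤ C * (1 + L) ^ p := by positivity
    have h1 : |E N * φ N| ≤ C * (1 + L) ^ p * (N * φ N) := by
      rw [abs_mul, abs_of_nonneg (hφ0 N)]
      calc |E N| * φ N ≤ (C * (1 + L) ^ p * N) * φ N :=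
            mul_le_mul_of_nonneg_right (hEle N hN1 le_rfl) (hφ0 N)
        _ = C * (1 + L) ^ p * (N * φ N) := by ring
    have h2 : ∀ k ∈ Finset.range N,
        |E k * (φ (k + 1) - φ k)| ≤ C * (1 + L) ^ p * (-((k : ℝ) * (φ (k + 1) - φ k))) := by
      intro k hk
      have hkN : k < N := Finset.mem_range.mp hk
      rcases Nat.eq_zero_or_pos k with rfl | hk1
      · rw [hE0, zero_mul, abs_zero, Nat.cast_zero, zero_mul, neg_zero, mul_zero]
      · have hΔ : φ (k + 1) - φ k ≤ 0 := sub_nonpos.mpr (hφanti k hk1)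
        rw [abs_mul, abs_of_nonpos hΔ]
        calc |E k| * -(φ (k + 1) - φ k) ≤ (C * (1 + L) ^ p * k) * -(φ (k + 1) - φ k) :=
              mul_le_mul_of_nonneg_right (hEle k hk1 hkN.le) (by linarith)
          _ = C * (1 + L) ^ p * (-((k : ℝ) * (φ (k + 1) - φ k))) := by ring
    calc |E N * φ N - ∑ k ∈ Finset.range N, E k * (φ (k + 1) - φ k)|
        ≤ |E N * φ N| + |∑ k ∈ Finset.range N, E k * (φ (k + 1) - φ k)| := abs_sub _ _
      _ ≤ C * (1 + L) ^ p * (N * φ N) +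
          ∑ k ∈ Finset.range N, C * (1 + L) ^ p * (-((k : ℝ) * (φ (k + 1) - φ k))) :=
          add_le_add h1 ((Finset.abs_sum_le_sum_abs _ _).trans (Finset.sum_le_sum h2))
      _ = C * (1 + L) ^ p * T := by
          rw [hA1, ← Finset.mul_sum, Finset.sum_neg_distrib]; ring
  -- Step 2: `S_ψ` against `∑ (log n)^{p+1} φ(n)`
  have hstep2 : |(∑ n ∈ Ioc 0 N, ((n : ℝ) * Real.log n ^ (p + 1) -
        ((n : ℝ) - 1) * Real.log ((n : ℝ) - 1) ^ (p + 1)) * φ n) -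
      ∑ n ∈ Ioc 0 N, Real.log n ^ (p + 1) * φ n| ≤ (p + 1) * L ^ p * T := by
    rw [← Finset.sum_sub_distrib]
    refine (Finset.abs_sum_le_sum_abs _ _).trans ?_
    rw [hT, Finset.mul_sum]
    refine Finset.sum_le_sum fun n hn => ?_
    obtain ⟨hn1, hnN⟩ := Finset.mem_Ioc.mp hn
    obtain ⟨hlo, hhi⟩ := model_increment_bounds p hn1
    have hn0 : (0 : ℝ) < n := by exact_mod_cast hn1
    have hln : Real.log n ≤ L := Real.log_le_log hn0 (le_trans (by exact_mod_cast hnN) hNx)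
    have hln0 : 0 ≤ Real.log n := Real.log_nonneg (by exact_mod_cast hn1)
    rw [← sub_mul, abs_mul, abs_of_nonneg (hφ0 n), abs_of_nonneg (by linarith)]
    calc ((n : ℝ) * Real.log n ^ (p + 1) - ((n : ℝ) - 1) * Real.log ((n : ℝ) - 1) ^ (p + 1) -
          Real.log n ^ (p + 1)) * φ n ≤ ((p + 1) * Real.log n ^ p) * φ n :=
          mul_le_mul_of_nonneg_right (by linarith) (hφ0 n)
      _ ≤ ((p + 1) * L ^ p) * φ n := by gcongr
  -- Step 3: `∑ (log n)^{p+1} φ(n)` by `abs_sum_pow_log_mul_pow_log_div_sub_le`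
  have hstep3 : |(∑ n ∈ Ioc 0 N, Real.log n ^ (p + 1) * φ n) -
      ((m.factorial : ℝ) * (p + 1).factorial) / ((m + (p + 1) + 1).factorial : ℝ) *
        L ^ (m + (p + 1) + 1)| ≤ 2 ^ (p + 1) * L ^ (m + (p + 1)) := by
    have h := abs_sum_pow_log_mul_pow_log_div_sub_le m (p + 1) hx
    have heq : ∑ n ∈ Ioc 0 N, Real.log n ^ (p + 1) * φ n =
        ∑ n ∈ Ioc 0 N, Real.log n ^ (p + 1) * Real.log (x / n) ^ m / n := by
      refine Finset.sum_congr rfl fun n hn => ?_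
      rw [hφeq n (Finset.mem_Ioc.mp hn).1 (Finset.mem_Ioc.mp hn).2, mul_div_assoc]
    rw [heq]
    exact h
  -- assembly
  have e1 : m + (p + 1) + 1 = m + p + 2 := by ring
  have e2 : m + (p + 1) = m + p + 1 := by ring
  rw [e1, e2] at hstep3
  rw [hSeq]
  have hLm : L ^ m * (1 + L) ≤ (1 + L) ^ (m + 1) := by
    rw [pow_succ]
    exact mul_le_mul_of_nonneg_right (pow_le_pow_left₀ hL0 (by linarith) _) (by linarith)
  have hT' : T ≤ (1 + L) ^ (m + 1) := hTle.trans hLm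
  have hLpow : ∀ a b : ℕ, L ^ a * (1 + L) ^ b ≤ (1 + L) ^ (a + b) := fun a b => by
    rw [pow_add]
    exact mul_le_mul_of_nonneg_right (pow_le_pow_left₀ hL0 (by linarith) _) (by positivity)
  -- the three pieces
  set Sg := ∑ n ∈ Ioc 0 N, g n * φ n with hSg
  set Sψ := ∑ n ∈ Ioc 0 N, ((n : ℝ) * Real.log n ^ (p + 1) -
    ((n : ℝ) - 1) * Real.log ((n : ℝ) - 1) ^ (p + 1)) * φ n with hSψ
  set Sl := ∑ n ∈ Ioc 0 N, Real.log n ^ (p + 1) * φ n with hSl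
  set Mn := ((m.factorial : ℝ) * (p + 1).factorial) / ((m + p + 2).factorial : ℝ) *
    L ^ (m + p + 2) with hMn
  have hid : Sg - c * (((m.factorial : ℝ) * (p + 1).factorial) / ((m + p + 2).factorial : ℝ)) *
      L ^ (m + p + 2) = (Sg - c * Sψ) + c * (Sψ - Sl) + c * (Sl - Mn) := by rw [hMn]; ring
  rw [hid]
  refine (abs_add_three _ _ _).trans ?_
  rw [abs_mul, abs_mul]
  have hb1 : |Sg - c * Sψ| ≤ C * (1 + L) ^ (m + p + 1) := by
    refine hstep1.trans ?_
    calc C * (1 + L) ^ p * T ≤ C * (1 + L) ^ p * (1 + L) ^ (m + 1) :=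
          mul_le_mul_of_nonneg_left hT' (by positivity)
      _ = C * (1 + L) ^ (m + p + 1) := by rw [mul_assoc, ← pow_add]; congr 2; ring
  have hb2 : |c| * |Sψ - Sl| ≤ |c| * ((p + 1) * (1 + L) ^ (m + p + 1)) := by
    refine mul_le_mul_of_nonneg_left (hstep2.trans ?_) (abs_nonneg c)
    calc (p + 1 : ℝ) * L ^ p * T ≤ (p + 1) * L ^ p * (1 + L) ^ (m + 1) :=
          mul_le_mul_of_nonneg_left hT' (by positivity)
      _ = (p + 1) * (L ^ p * (1 + L) ^ (m + 1)) := by ring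
      _ ≤ (p + 1) * (1 + L) ^ (m + p + 1) := by
          refine mul_le_mul_of_nonneg_left ?_ (by positivity)
          calc L ^ p * (1 + L) ^ (m + 1) ≤ (1 + L) ^ (p + (m + 1)) := hLpow p (m + 1)
            _ = (1 + L) ^ (m + p + 1) := by congr 1; ring
  have hb3 : |c| * |Sl - Mn| ≤ |c| * (2 ^ (p + 1) * (1 + L) ^ (m + p + 1)) := by
    refine mul_le_mul_of_nonneg_left (hstep3.trans ?_) (abs_nonneg c)
    exact mul_le_mul_of_nonneg_left (pow_le_pow_left₀ hL0 (by linarith) _) (by positivity)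
  calc |Sg - c * Sψ| + |c| * |Sψ - Sl| + |c| * |Sl - Mn|
      ≤ C * (1 + L) ^ (m + p + 1) + |c| * ((p + 1) * (1 + L) ^ (m + p + 1)) +
          |c| * (2 ^ (p + 1) * (1 + L) ^ (m + p + 1)) := add_le_add (add_le_add hb1 hb2) hb3
    _ = (|c| * 2 ^ (p + 1) + |c| * (p + 1) + C) * (1 + L) ^ (m + p + 1) := by ring
    _ ≤ (|c| * 2 ^ (p + 1) + |c| * (p + 1) * 2 + C * 2) * (1 + L) ^ (m + p + 1) := by
        apply mul_le_mul_of_nonneg_right _ (by positivity)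
        nlinarith [abs_nonneg c, hC0]

/-! ### Convolution with `Λ` (prepending a rank `1`) -/

/-- **Prepending a rank `1`.** If `|∑_{n ≤ y} g(n) − c y (log y)^{p+1}| ≤ C y (1 + log y)^p` for
`y ≥ 1`, then `∑_{n ≤ x} (Λ ∗ g)(n) = (c/(p+2)) x (log x)^{p+2} + O(x (1 + log x)^{p+1})`:
open the convolution as `∑_{d ≤ x} Λ(d) G(x/d)` and use the weighted Mertens estimate
`∑_{d ≤ x} Λ(d) d⁻¹ (log x/d)^{p+1} = (log x)^{p+2}/(p+2) + O((log x)^{p+1})`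
(`abs_sum_vonMangoldt_div_mul_pow_log_sub_le`) and `∑_{d ≤ x} Λ(d)/d ≤ log x + 6`; no prime
number theorem is involved. [folklore] -/
theorem vonMangoldt_mul_summatory (g : ArithmeticFunction ℝ) {c C : ℝ} {p : ℕ}
    (hg : ∀ y : ℝ, 1 ≤ y →
      |∑ n ∈ Ioc 0 ⌊y⌋₊, g n - c * y * Real.log y ^ (p + 1)| ≤ C * y * (1 + Real.log y) ^ p) :
    ∃ C' : ℝ, ∀ x : ℝ, 1 ≤ x →
      |∑ n ∈ Ioc 0 ⌊x⌋₊, (Λ * g) n - c / (p + 2) * x * Real.log x ^ (p + 2)| ≤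
        C' * x * (1 + Real.log x) ^ (p + 1) := by
  have hC0 : 0 ≤ C := by
    have h := hg 1 le_rfl
    have h2 : (0 : ℝ) ≤ C * 1 * (1 + Real.log 1) ^ p := (abs_nonneg _).trans h
    simpa using h2
  refine ⟨6 * |c| + 6 * C, fun x hx => ?_⟩
  set N := ⌊x⌋₊ with hN
  set L := Real.log x with hL
  have hx0 : 0 < x := by linarith
  have hL0 : 0 ≤ L := Real.log_nonneg hx
  have hp2 : (0 : ℝ) < (p : ℝ) + 2 := by positivity
  -- open the convolution
  have hopen : ∑ n ∈ Ioc 0 N, (Λ * g) n = ∑ d ∈ Ioc 0 N, Λ d * ∑ e ∈ Ioc 0 ⌊x / d⌋₊, g e := by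
    rw [ArithmeticFunction.sum_Ioc_mul_eq_sum_sum]
    refine Finset.sum_congr rfl fun d _ => ?_
    rw [Nat.floor_div_natCast]
  -- termwise
  have hterm : ∀ d ∈ Ioc 0 N,
      |Λ d * ∑ e ∈ Ioc 0 ⌊x / d⌋₊, g e - c * x * (Λ d / d * Real.log (x / d) ^ (p + 1))| ≤
        C * x * (1 + L) ^ p * (Λ d / d) := by
    intro d hd
    obtain ⟨hd0, hdN⟩ := Finset.mem_Ioc.mp hd
    have hd0' : (0 : ℝ) < d := by exact_mod_cast hd0
    have h1d : (1 : ℝ) ≤ d := by exact_mod_cast hd0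
    have hdx : (d : ℝ) ≤ x := le_trans (by exact_mod_cast hdN) (Nat.floor_le hx0.le)
    have hy : 1 ≤ x / d := by rwa [le_div_iff₀ hd0', one_mul]
    have h := hg (x / d) hy
    have hΛ : 0 ≤ Λ d := vonMangoldt_nonneg
    have hlxd : Real.log (x / d) ≤ L := by
      rw [Real.log_div hx0.ne' hd0'.ne']; linarith [Real.log_nonneg h1d]
    have hlxd0 : 0 ≤ Real.log (x / d) := Real.log_nonneg hy
    have heq : Λ d * ∑ e ∈ Ioc 0 ⌊x / d⌋₊, g e - c * x * (Λ d / d * Real.log (x / d) ^ (p + 1)) =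
        Λ d * ((∑ e ∈ Ioc 0 ⌊x / d⌋₊, g e) - c * (x / d) * Real.log (x / d) ^ (p + 1)) := by
      field_simp
    rw [heq, abs_mul, abs_of_nonneg hΛ]
    calc Λ d * |(∑ e ∈ Ioc 0 ⌊x / d⌋₊, g e) - c * (x / d) * Real.log (x / d) ^ (p + 1)|
        ≤ Λ d * (C * (x / d) * (1 + Real.log (x / d)) ^ p) := mul_le_mul_of_nonneg_left h hΛ
      _ ≤ Λ d * (C * (x / d) * (1 + L) ^ p) := by gcongr
      _ = C * x * (1 + L) ^ p * (Λ d / d) := by field_simp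
  have hE : |∑ d ∈ Ioc 0 N, Λ d * ∑ e ∈ Ioc 0 ⌊x / d⌋₊, g e -
      c * x * ∑ d ∈ Ioc 0 N, Λ d / d * Real.log (x / d) ^ (p + 1)| ≤
      C * x * (1 + L) ^ p * (L + 6) := by
    have hM := (abs_le.mp (abs_sum_vonMangoldt_div_sub_log_le hx)).2
    rw [Finset.mul_sum, ← Finset.sum_sub_distrib]
    refine (Finset.abs_sum_le_sum_abs _ _).trans ?_
    refine (Finset.sum_le_sum hterm).trans ?_
    rw [← Finset.mul_sum]
    have hM' : ∑ d ∈ Ioc 0 N, Λ d / d ≤ L + 6 := by linarith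
    exact mul_le_mul_of_nonneg_left hM' (by positivity)
  have hW := abs_sum_vonMangoldt_div_mul_pow_log_sub_le hx p
  -- assembly
  rw [hopen]
  have hid : ∑ d ∈ Ioc 0 N, Λ d * ∑ e ∈ Ioc 0 ⌊x / d⌋₊, g e - c / (p + 2) * x * L ^ (p + 2) =
      (∑ d ∈ Ioc 0 N, Λ d * ∑ e ∈ Ioc 0 ⌊x / d⌋₊, g e -
        c * x * ∑ d ∈ Ioc 0 N, Λ d / d * Real.log (x / d) ^ (p + 1)) +
      c * x * (∑ d ∈ Ioc 0 N, Λ d / d * Real.log (x / d) ^ (p + 1) - L ^ (p + 2) / (p + 2)) := by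
    field_simp
    ring
  rw [hid]
  refine (abs_add_le _ _).trans ?_
  rw [abs_mul, abs_mul, abs_of_pos hx0]
  have h2 : |c| * x * |∑ d ∈ Ioc 0 N, Λ d / d * Real.log (x / d) ^ (p + 1) - L ^ (p + 2) / (p + 2)| ≤
      |c| * x * (6 * L ^ (p + 1)) := by
    exact mul_le_mul_of_nonneg_left hW (by positivity)
  have hL1 : L ^ (p + 1) ≤ (1 + L) ^ (p + 1) := pow_le_pow_left₀ hL0 (by linarith) _
  have hL2 : (1 + L) ^ p * (L + 6) ≤ 6 * (1 + L) ^ (p + 1) := by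
    rw [pow_succ]; nlinarith [pow_nonneg (by linarith : (0 : ℝ) ≤ 1 + L) p]
  calc |∑ d ∈ Ioc 0 N, Λ d * ∑ e ∈ Ioc 0 ⌊x / d⌋₊, g e -
          c * x * ∑ d ∈ Ioc 0 N, Λ d / d * Real.log (x / d) ^ (p + 1)| +
        |c| * x * |∑ d ∈ Ioc 0 N, Λ d / d * Real.log (x / d) ^ (p + 1) - L ^ (p + 2) / (p + 2)|
      ≤ C * x * (1 + L) ^ p * (L + 6) + |c| * x * (6 * L ^ (p + 1)) := add_le_add hE h2
    _ = C * x * ((1 + L) ^ p * (L + 6)) + 6 * |c| * x * L ^ (p + 1) := by ring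
    _ ≤ C * x * (6 * (1 + L) ^ (p + 1)) + 6 * |c| * x * (1 + L) ^ (p + 1) := by
        gcongr
    _ = (6 * |c| + 6 * C) * x * (1 + L) ^ (p + 1) := by ring

/-! ### Convolution of two functions with logarithmic-power asymptotics (prepending a rank `≥ 2`) -/

/-- A crude consequence of `weighted_sum_asymp` (`m = 0`): `∑_{n ≤ x} g(n)/n ≤ C'(1 + log x)^{p+2}`
when `|∑_{n ≤ y} g(n) − c y (log y)^{p+1}| ≤ C y (1 + log y)^p`. [folklore] -/
theorem sum_div_le_of_summatory (g : ℕ → ℝ) {c C : ℝ} {p : ℕ}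
    (hg : ∀ y : ℝ, 1 ≤ y →
      |∑ n ∈ Ioc 0 ⌊y⌋₊, g n - c * y * Real.log y ^ (p + 1)| ≤ C * y * (1 + Real.log y) ^ p) :
    ∃ C' : ℝ, 0 ≤ C' ∧ ∀ x : ℝ, 1 ≤ x →
      ∑ n ∈ Ioc 0 ⌊x⌋₊, g n / n ≤ C' * (1 + Real.log x) ^ (p + 2) := by
  obtain ⟨C₁, hC₁⟩ := weighted_sum_asymp g hg 0
  refine ⟨|c| + |C₁|, by positivity, fun x hx => ?_⟩
  have h := hC₁ x hx
  set L := Real.log x with hL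
  have hL0 : 0 ≤ L := Real.log_nonneg hx
  have h1L : 1 ≤ 1 + L := by linarith
  simp only [pow_zero, mul_one, Nat.factorial_zero, Nat.cast_one, one_mul, zero_add] at h
  have hfac : ((p + 1).factorial : ℝ) / ((p + 2).factorial : ℝ) ≤ 1 := by
    rw [div_le_one (by exact_mod_cast Nat.factorial_pos _)]
    exact_mod_cast Nat.factorial_le (by omega)
  have hfac0 : 0 ≤ ((p + 1).factorial : ℝ) / ((p + 2).factorial : ℝ) := by positivity
  have hup := (abs_le.mp h).2
  calc ∑ n ∈ Ioc 0 ⌊x⌋₊, g n / n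
      ≤ c * (((p + 1).factorial : ℝ) / ((p + 2).factorial : ℝ)) * L ^ (p + 2) +
          C₁ * (1 + L) ^ (p + 1) := by linarith
    _ ≤ |c| * 1 * (1 + L) ^ (p + 2) + |C₁| * (1 + L) ^ (p + 2) := by
        refine add_le_add ?_ ?_
        · calc c * (((p + 1).factorial : ℝ) / ((p + 2).factorial : ℝ)) * L ^ (p + 2)
              ≤ |c * (((p + 1).factorial : ℝ) / ((p + 2).factorial : ℝ)) * L ^ (p + 2)| :=
                le_abs_self _
            _ = |c| * (((p + 1).factorial : ℝ) / ((p + 2).factorial : ℝ)) * L ^ (p + 2) := by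
                rw [abs_mul, abs_mul, abs_of_nonneg hfac0, abs_of_nonneg (pow_nonneg hL0 _)]
            _ ≤ |c| * 1 * (1 + L) ^ (p + 2) := by
                gcongr
                linarith
        · calc C₁ * (1 + L) ^ (p + 1) ≤ |C₁| * (1 + L) ^ (p + 1) :=
              mul_le_mul_of_nonneg_right (le_abs_self _) (by positivity)
            _ ≤ |C₁| * (1 + L) ^ (p + 2) :=
              mul_le_mul_of_nonneg_left (pow_le_pow_right₀ h1L (by omega)) (abs_nonneg _)
    _ = (|c| + |C₁|) * (1 + L) ^ (p + 2) := by ring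

/-- **Prepending a rank `≥ 2`: convolution of two functions with logarithmic-power asymptotics.**
If `|∑_{n ≤ y} f(n) − c_f y (log y)^{q+1}| ≤ C_f y (1 + log y)^q` and `g ≥ 0` satisfies
`|∑_{n ≤ y} g(n) − c y (log y)^{p+1}| ≤ C y (1 + log y)^p` (`y ≥ 1`), then
`∑_{n ≤ x} (g ∗ f)(n) = c_f c ((q+1)!(p+1)!/(p+q+3)!) x (log x)^{p+q+3} + O(x(1 + log x)^{p+q+2})`:
open the convolution as `∑_{d ≤ x} g(d) F(x/d)` and use `weighted_sum_asymp` for the main term,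
`sum_div_le_of_summatory` for the error. The Beta factor `(q+1)!(p+1)!/(p+q+3)!` is what makes
`γ_{(k)} = (k)!/(|k|−1)!` multiplicative along the induction. [folklore] -/
theorem mul_summatory (f g : ArithmeticFunction ℝ) (hg0 : ∀ n, 0 ≤ g n) {cf Cf c C : ℝ}
    {q p : ℕ}
    (hf : ∀ y : ℝ, 1 ≤ y →
      |∑ n ∈ Ioc 0 ⌊y⌋₊, f n - cf * y * Real.log y ^ (q + 1)| ≤ Cf * y * (1 + Real.log y) ^ q)
    (hg : ∀ y : ℝ, 1 ≤ y →
      |∑ n ∈ Ioc 0 ⌊y⌋₊, g n - c * y * Real.log y ^ (p + 1)| ≤ C * y * (1 + Real.log y) ^ p) :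
    ∃ C' : ℝ, ∀ x : ℝ, 1 ≤ x →
      |∑ n ∈ Ioc 0 ⌊x⌋₊, (g * f) n -
          cf * c * ((((q + 1).factorial : ℝ) * (p + 1).factorial) / ((p + q + 3).factorial : ℝ)) *
            x * Real.log x ^ (p + q + 3)| ≤ C' * x * (1 + Real.log x) ^ (p + q + 2) := by
  have hCf0 : 0 ≤ Cf := by
    have h := hf 1 le_rfl
    have h2 : (0 : ℝ) ≤ Cf * 1 * (1 + Real.log 1) ^ q := (abs_nonneg _).trans h
    simpa using h2
  obtain ⟨C₁, hC₁⟩ := weighted_sum_asymp (fun n => g n) hg (q + 1)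
  obtain ⟨C₂, hC₂0, hC₂⟩ := sum_div_le_of_summatory (fun n => g n) hg
  refine ⟨|cf| * |C₁| + Cf * C₂, fun x hx => ?_⟩
  set N := ⌊x⌋₊ with hN
  set L := Real.log x with hL
  have hx0 : 0 < x := by linarith
  have hL0 : 0 ≤ L := Real.log_nonneg hx
  have h1L : 1 ≤ 1 + L := by linarith
  -- open the convolution
  have hopen : ∑ n ∈ Ioc 0 N, (g * f) n = ∑ d ∈ Ioc 0 N, g d * ∑ e ∈ Ioc 0 ⌊x / d⌋₊, f e := by
    rw [ArithmeticFunction.sum_Ioc_mul_eq_sum_sum]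
    refine Finset.sum_congr rfl fun d _ => ?_
    rw [Nat.floor_div_natCast]
  -- termwise
  have hterm : ∀ d ∈ Ioc 0 N,
      |g d * ∑ e ∈ Ioc 0 ⌊x / d⌋₊, f e - cf * x * (g d / d * Real.log (x / d) ^ (q + 1))| ≤
        Cf * x * (1 + L) ^ q * (g d / d) := by
    intro d hd
    obtain ⟨hd0, hdN⟩ := Finset.mem_Ioc.mp hd
    have hd0' : (0 : ℝ) < d := by exact_mod_cast hd0
    have h1d : (1 : ℝ) ≤ d := by exact_mod_cast hd0
    have hdx : (d : ℝ) ≤ x := le_trans (by exact_mod_cast hdN) (Nat.floor_le hx0.le)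
    have hy : 1 ≤ x / d := by rwa [le_div_iff₀ hd0', one_mul]
    have h := hf (x / d) hy
    have hgd : 0 ≤ g d := hg0 d
    have hlxd : Real.log (x / d) ≤ L := by
      rw [Real.log_div hx0.ne' hd0'.ne']; linarith [Real.log_nonneg h1d]
    have hlxd0 : 0 ≤ Real.log (x / d) := Real.log_nonneg hy
    have heq : g d * ∑ e ∈ Ioc 0 ⌊x / d⌋₊, f e - cf * x * (g d / d * Real.log (x / d) ^ (q + 1)) =
        g d * ((∑ e ∈ Ioc 0 ⌊x / d⌋₊, f e) - cf * (x / d) * Real.log (x / d) ^ (q + 1)) := by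
      field_simp
    rw [heq, abs_mul, abs_of_nonneg hgd]
    calc g d * |(∑ e ∈ Ioc 0 ⌊x / d⌋₊, f e) - cf * (x / d) * Real.log (x / d) ^ (q + 1)|
        ≤ g d * (Cf * (x / d) * (1 + Real.log (x / d)) ^ q) := mul_le_mul_of_nonneg_left h hgd
      _ ≤ g d * (Cf * (x / d) * (1 + L) ^ q) := by gcongr
      _ = Cf * x * (1 + L) ^ q * (g d / d) := by field_simp
  have hE : |∑ d ∈ Ioc 0 N, g d * ∑ e ∈ Ioc 0 ⌊x / d⌋₊, f e -
      cf * x * ∑ d ∈ Ioc 0 N, g d / d * Real.log (x / d) ^ (q + 1)| ≤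
      Cf * x * (1 + L) ^ q * (C₂ * (1 + L) ^ (p + 2)) := by
    rw [Finset.mul_sum, ← Finset.sum_sub_distrib]
    refine (Finset.abs_sum_le_sum_abs _ _).trans ?_
    refine (Finset.sum_le_sum hterm).trans ?_
    rw [← Finset.mul_sum]
    exact mul_le_mul_of_nonneg_left (hC₂ x hx) (by positivity)
  have hW := hC₁ x hx
  have e1 : q + 1 + p + 2 = p + q + 3 := by ring
  have e2 : q + 1 + p + 1 = p + q + 2 := by ring
  rw [e1, e2] at hW
  -- assembly
  rw [hopen]
  set K := (((q + 1).factorial : ℝ) * (p + 1).factorial) / ((p + q + 3).factorial : ℝ) with hK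
  set W := ∑ d ∈ Ioc 0 N, g d / d * Real.log (x / d) ^ (q + 1) with hWdef
  have hid : ∑ d ∈ Ioc 0 N, g d * ∑ e ∈ Ioc 0 ⌊x / d⌋₊, f e - cf * c * K * x * L ^ (p + q + 3) =
      (∑ d ∈ Ioc 0 N, g d * ∑ e ∈ Ioc 0 ⌊x / d⌋₊, f e - cf * x * W) +
        cf * x * (W - c * K * L ^ (p + q + 3)) := by ring
  rw [hid]
  refine (abs_add_le _ _).trans ?_
  rw [abs_mul, abs_mul, abs_of_pos hx0]
  have hW' : |∑ n ∈ Ioc 0 N, g n / n * Real.log (x / n) ^ (q + 1) - c * K * L ^ (p + q + 3)| ≤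
      |C₁| * (1 + L) ^ (p + q + 2) := by
    refine le_trans (le_of_eq ?_) (hW.trans (mul_le_mul_of_nonneg_right (le_abs_self _)
      (by positivity)))
    rw [hK, mul_assoc c]
  have h2 : |cf| * x * |W - c * K * L ^ (p + q + 3)| ≤ |cf| * x * (|C₁| * (1 + L) ^ (p + q + 2)) :=
    mul_le_mul_of_nonneg_left hW' (by positivity)
  calc |∑ d ∈ Ioc 0 N, g d * ∑ e ∈ Ioc 0 ⌊x / d⌋₊, f e - cf * x * W| +
        |cf| * x * |W - c * K * L ^ (p + q + 3)|
      ≤ Cf * x * (1 + L) ^ q * (C₂ * (1 + L) ^ (p + 2)) + |cf| * x * (|C₁| * (1 + L) ^ (p + q + 2)) :=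
        add_le_add hE h2
    _ = (|cf| * |C₁| + Cf * C₂) * x * (1 + L) ^ (p + q + 2) := by
        have : (1 + L) ^ q * (1 + L) ^ (p + 2) = (1 + L) ^ (p + q + 2) := by
          rw [← pow_add]; congr 1; ring
        calc Cf * x * (1 + L) ^ q * (C₂ * (1 + L) ^ (p + 2)) +
              |cf| * x * (|C₁| * (1 + L) ^ (p + q + 2))
            = Cf * C₂ * x * ((1 + L) ^ q * (1 + L) ^ (p + 2)) +
                |cf| * |C₁| * x * (1 + L) ^ (p + q + 2) := by ring
          _ = _ := by rw [this]; ring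

/-! ### [FriedlanderIwaniecPisa1978] Lemma 3 for a vector, by induction over the ranks -/

/-- **[FriedlanderIwaniecPisa1978] Lemma 3 for `K = ℚ` and a vector `(k) = (k', a)`, `a ≥ 2`**
(p. 727: `∑_{m ≤ x} Λ_{(k)}(m) = γ_{(k)} x (log x)^{|k|−1} + O(x (log x)^{|k|−2})`,
`γ_{(k)} = (k)!/(|k|−1)!`), in the form: for every list of ranks `l` and every `a ≥ 2` there is `C`
with `|∑_{n ≤ x} Λ_(l, a)(n) − ((l,a)!/(|l|+a−1)!) x (log x)^{|l|+a−1}| ≤ C x (1 + log x)^{|l|+a−2}`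
for all `x ≥ 1`. Induction on `l`: the base is the scalar Lemma 3
(`generalizedVonMangoldt_summatory`); a rank `0` is dropped (`Λ₀ = δ`), a rank `1` is
`vonMangoldt_mul_summatory`, a rank `q + 2` is `mul_summatory` with the scalar Lemma 3 for
`Λ_{q+2}`; the constants multiply to `γ_{(k)}`. (FI induct from the prime ideal theorem; here no
prime number theorem is used, the base being Selberg's formula.)
[cite: FriedlanderIwaniecPisa1978, Lemma 3 (K = Q)] -/
theorem lambdaVec_concat_summatory (l : List ℕ) {a : ℕ} (ha : 2 ≤ a) :
    ∃ C : ℝ, ∀ x : ℝ, 1 ≤ x →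
      |∑ n ∈ Ioc 0 ⌊x⌋₊, ((l ++ [a]).map generalizedVonMangoldt).prod n -
          (((l ++ [a]).map Nat.factorial).prod : ℝ) / (((l ++ [a]).sum - 1).factorial : ℝ) *
            x * Real.log x ^ ((l ++ [a]).sum - 1)| ≤
        C * x * (1 + Real.log x) ^ ((l ++ [a]).sum - 2) := by
  induction l with
  | nil =>
    obtain ⟨p, rfl⟩ : ∃ p, a = p + 2 := ⟨a - 2, by omega⟩
    obtain ⟨C, hC⟩ := generalizedVonMangoldt_summatory p
    refine ⟨C, fun x hx => ?_⟩
    have hfac : (((p + 2).factorial : ℕ) : ℝ) / (((p + 1).factorial : ℕ) : ℝ) = (p : ℝ) + 2 := by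
      have h0 : (((p + 1).factorial : ℕ) : ℝ) ≠ 0 := by exact_mod_cast (Nat.factorial_pos _).ne'
      rw [div_eq_iff h0, Nat.factorial_succ (p + 1)]
      push_cast
      ring
    have h := hC x hx
    simp only [List.nil_append, List.map_cons, List.map_nil, List.prod_cons, List.prod_nil,
      mul_one, List.sum_cons, List.sum_nil, add_zero, show p + 2 - 1 = p + 1 from rfl,
      show p + 2 - 2 = p from rfl, hfac]
    exact h
  | cons k l ih =>
    obtain ⟨C, hC⟩ := ih
    -- the tail: its weight `g`, factorial product `P` and rank sum `s = p + 2`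
    have hs2 : 2 ≤ (l ++ [a]).sum := le_trans ha (List.le_sum_of_mem (by simp))
    obtain ⟨p, hp⟩ : ∃ p, (l ++ [a]).sum = p + 2 := ⟨(l ++ [a]).sum - 2, by omega⟩
    rw [hp, show p + 2 - 1 = p + 1 from rfl, show p + 2 - 2 = p from rfl] at hC
    set g := ((l ++ [a]).map generalizedVonMangoldt).prod with hg
    set P := ((l ++ [a]).map Nat.factorial).prod with hP
    have hg0 : ∀ n, 0 ≤ g n := lambdaVec_nonneg (l ++ [a])
    have hPpos : (0 : ℝ) < P := by
      rw [hP]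
      exact_mod_cast List.prod_pos (fun m hm => by
        obtain ⟨i, -, rfl⟩ := List.mem_map.mp hm
        exact Nat.factorial_pos i)
    -- the new list
    have e_map : (((k :: l) ++ [a]).map generalizedVonMangoldt).prod = generalizedVonMangoldt k * g := by
      rw [List.cons_append, List.map_cons, List.prod_cons]
    have e_fac : (((k :: l) ++ [a]).map Nat.factorial).prod = k.factorial * P := by
      rw [List.cons_append, List.map_cons, List.prod_cons]
    have e_sum : ((k :: l) ++ [a]).sum = k + (p + 2) := by
      rw [List.cons_append, List.sum_cons, hp]
    rw [e_map, e_fac, e_sum]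
    have hf1 : (((p + 1).factorial : ℕ) : ℝ) ≠ 0 := by exact_mod_cast (Nat.factorial_pos _).ne'
    rcases Nat.lt_or_ge k 2 with hk | hk
    · interval_cases k
      · -- rank `0`: nothing changes
        refine ⟨C, fun x hx => ?_⟩
        have h := hC x hx
        rw [generalizedVonMangoldt_zero, one_mul, Nat.factorial_zero, one_mul,
          show 0 + (p + 2) - 1 = p + 1 from by omega, show 0 + (p + 2) - 2 = p from by omega]
        exact h
      · -- rank `1`: convolution with `Λ`
        obtain ⟨C', hC'⟩ := vonMangoldt_mul_summatory g hC
        refine ⟨C', fun x hx => ?_⟩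
        have h := hC' x hx
        have hγ : (((Nat.factorial 1 * P : ℕ) : ℝ)) / (((p + 2).factorial : ℕ) : ℝ) =
            (P : ℝ) / (((p + 1).factorial : ℕ) : ℝ) / ((p : ℝ) + 2) := by
          rw [Nat.factorial_one, one_mul, Nat.factorial_succ (p + 1)]
          push_cast
          field_simp
          ring
        rw [generalizedVonMangoldt_one, show 1 + (p + 2) - 1 = p + 2 from by omega,
          show 1 + (p + 2) - 2 = p + 1 from by omega, hγ]
        exact h
    · -- rank `q + 2 ≥ 2`: convolution of two functions with logarithmic-power asymptotics
      obtain ⟨q, rfl⟩ : ∃ q, k = q + 2 := ⟨k - 2, by omega⟩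
      obtain ⟨Cf, hCf⟩ := generalizedVonMangoldt_summatory q
      obtain ⟨C', hC'⟩ := mul_summatory (generalizedVonMangoldt (q + 2)) g hg0 hCf hC
      refine ⟨C', fun x hx => ?_⟩
      have h := hC' x hx
      have hγ : ((((q + 2).factorial * P : ℕ) : ℝ)) / (((p + q + 3).factorial : ℕ) : ℝ) =
          ((q : ℝ) + 2) * ((P : ℝ) / (((p + 1).factorial : ℕ) : ℝ)) *
            ((((q + 1).factorial : ℝ) * (p + 1).factorial) / ((p + q + 3).factorial : ℝ)) := by
        have h3 : (((p + q + 3).factorial : ℕ) : ℝ) ≠ 0 := by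
          exact_mod_cast (Nat.factorial_pos _).ne'
        rw [Nat.factorial_succ (q + 1)]
        push_cast
        field_simp
        ring
      rw [mul_comm (generalizedVonMangoldt (q + 2)) g,
        show q + 2 + (p + 2) - 1 = p + q + 3 from by omega,
        show q + 2 + (p + 2) - 2 = p + q + 2 from by omega, hγ]
      exact h

/-- The main-term evaluation in the `ε`-form used in the proof of Theorem 1: for every list `l`,
every `a ≥ 2` and every `ε > 0`, for all large `x`,
`|∑_{n ≤ x} Λ_(l, a)(n) − γ x (log x)^{K−1}| ≤ ε x (log x)^{K−1}` (`K = |l| + a`,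
`γ = (l, a)!/(K−1)!`), since `(1 + log x)^{K−2} = o((log x)^{K−1})`. [folklore] -/
theorem lambdaVec_concat_summatory_eventually (l : List ℕ) {a : ℕ} (ha : 2 ≤ a) {ε : ℝ}
    (hε : 0 < ε) : ∀ᶠ x : ℝ in atTop,
      |∑ n ∈ Ioc 0 ⌊x⌋₊, ((l ++ [a]).map generalizedVonMangoldt).prod n -
          (((l ++ [a]).map Nat.factorial).prod : ℝ) / (((l ++ [a]).sum - 1).factorial : ℝ) *
            x * Real.log x ^ ((l ++ [a]).sum - 1)| ≤
        ε * x * Real.log x ^ ((l ++ [a]).sum - 1) := by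
  obtain ⟨C, hC⟩ := lambdaVec_concat_summatory l ha
  have hs2 : 2 ≤ (l ++ [a]).sum := le_trans ha (List.le_sum_of_mem (by simp))
  obtain ⟨p, hp⟩ : ∃ p, (l ++ [a]).sum = p + 2 := ⟨(l ++ [a]).sum - 2, by omega⟩
  rw [hp] at hC ⊢
  simp only [show p + 2 - 1 = p + 1 from rfl, show p + 2 - 2 = p from rfl] at hC ⊢
  -- `C (1 + L)^p ≤ ε L^{p+1}` once `L ≥ max(1, 2^p C / ε)`... via `(1+L)^p ≤ 2^p L^p` for `L ≥ 1`
  filter_upwards [eventually_ge_atTop (3 : ℝ),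
    Real.tendsto_log_atTop.eventually_ge_atTop (2 ^ p * max C 0 / ε)] with x hx3 hxL
  have hx1 : 1 ≤ x := by linarith
  have hx0 : 0 < x := by linarith
  set L := Real.log x with hL
  have hL1 : 1 ≤ L :=
    LFunctions.MertensBound.one_lt_log_three.le.trans (Real.log_le_log (by norm_num) hx3)
  have hL0 : 0 ≤ L := by linarith
  refine (hC x hx1).trans ?_
  have h1 : (1 + L) ^ p ≤ 2 ^ p * L ^ p := by
    rw [← mul_pow]; exact pow_le_pow_left₀ (by linarith) (by linarith) _
  have h2 : 2 ^ p * max C 0 ≤ ε * L := by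
    rw [div_le_iff₀ hε] at hxL; linarith
  calc C * x * (1 + L) ^ p ≤ max C 0 * x * (1 + L) ^ p := by
        gcongr; exact le_max_left _ _
    _ ≤ max C 0 * x * (2 ^ p * L ^ p) := by gcongr
    _ = (2 ^ p * max C 0) * x * L ^ p := by ring
    _ ≤ (ε * L) * x * L ^ p := by gcongr
    _ = ε * x * L ^ (p + 1) := by ring

end BombieriSieve

end Literature.NumberTheory.Sieve

end
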